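import Summits.CriticalPhenomena.CardyFormulaZ2.Theorems.CardyUSTContinuationKirchhoffExtremalLengthG02Cross1

/-!
# The crosscut loop: the crossing with `Γ_H`, and the flux identity (G02 discretisation)

Support file for `KirchhoffExtremalLength` (route CardyUSTContinuation of `CardyFormulaZ2`, item
stmt-CriticalPhenomena-11234), towards the upper half of `G02ModulusConvergence` (`…Defs.lean`).
Two lattice steps of the identification `h'(r) - h'(l) = ± I` ([GP19] §3) for
`Ω_δ = discreteDomainGraph Ω δ`, extracted from the tree's `SquareTiling.exists_exits_flux_eq`
(Steps 5–8 there) with the loop `Λ` and what its squares avoid as hypotheses: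

* `walkWinding_sub_eq_one_of_crossData`: if the squares of the closed walk
  `Λ = Λ₁ ++ (column) ++ Λ₂` avoid the outer pieces of the horizontal curve `Γ_H` of the cross and
  those of `Λ₁`, `Λ₂` avoid its straight middle piece, then the winding numbers of `Λ` around the
  squares of the two end points of `Γ_H` differ by `1` (`SquareTiling.walkWinding_sub_eq_one_of_cross`);
* `faceExitVal_sub_eq_of_crossData`: if moreover `Λ = (n_b → p_b) ++ v ++ (p_t → n_t) ++ β` with
  `v` inner, `β` flux-free, and `Λ` avoids the faces at the discrete arcs `A_δ`, `B_δ`, then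
  `E(p_t, n_t) - E(p_b, n_b) = ± Σ_{x ∈ A_δ} div(x)` (`faceExitVal_sub_faceExitVal_eq`).
-/

noncomputable section

namespace Summit.CriticalPhenomena.CardyFormulaZ2.Theorems

namespace KirchhoffSlope

open Set Metric Filter Topology SimpleGraph
open Literature.Probability Literature.Probability.LatticeModels Literature.Probability.Percolation
open Literature.Probability.LatticeModels.SquareTiling (walkFlux closedSq floorSq mem_closedSq_floorSq
  dist_le_of_mem_closedSq exists_dualWalk_of_path near_of_shadow lineMap_props floorSq_mk upRun
  walkWinding_sub_eq_one_of_cross walkWinding_eq_of_walk_closed not_near_both divAt)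
open Literature.Probability.RandomPlanarGeometry

variable {δ : ℝ}

/-! ### The crossing of the loop with `Γ_H` -/

/-- **The loop crosses `Γ_H` once.** Cross data: `Γ_H` continuous on `[0,1]`, straightened
through `B(c₀, r)` as `Γ_H|[0,sᵢ] ++ [Γ_H sᵢ, Q_h⁻] ++ [Q_h⁻, Q_h⁺] ++ [Q_h⁺, Γ_H sₒ] ++ Γ_H|[sₒ,1]`
with `Q_h^∓ = (c₀.re ∓ r/2, ys)`. If the squares of the closed lattice walk
`Λ = Λ₁ ++ upRun C k ++ Λ₂` touch none of the four outer pieces, the squares of `Λ₁`, `Λ₂` do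
not touch the middle segment, and the column `upRun C k` crosses the row of `ys` strictly
between the columns of `Q_h⁻` and `Q_h⁺`, then
`wind(Λ, ⌊Γ_H 0⌋) - wind(Λ, ⌊Γ_H 1⌋) = 1`. [cite: GeorgakopoulosPanagiotis2019, §3 (duality, on `ℤ²`)] -/
theorem walkWinding_sub_eq_one_of_crossData (hδ : 0 < δ) {ΓH : ℝ → ℂ} {c₀ : ℂ} {r ys sᵢ sₒ : ℝ}
    (hHc : ContinuousOn ΓH (Icc 0 1)) (hr : 0 < r) (hsᵢ : 0 < sᵢ) (hsᵢₒ : sᵢ < sₒ) (hsₒ : sₒ < 1)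
    {C nb : Site 2} {k : ℕ} (Λ₁ : (zdGraph 2).Walk nb C) (Λ₂ : (zdGraph 2).Walk (C + (k : ℤ) • Pi.single 1 1) nb)
    (hBout : ∀ q ∈ ((Λ₁.append (upRun C k)).append Λ₂).support,
      ¬ ∃ y ∈ ΓH '' Icc 0 sᵢ ∪ segment ℝ (ΓH sᵢ) ⟨c₀.re - r / 2, ys⟩ ∪ segment ℝ ⟨c₀.re + r / 2, ys⟩ (ΓH sₒ) ∪ ΓH '' Icc sₒ 1,
        y ∈ closedSq δ q)
    (hB3₁ : ∀ q ∈ Λ₁.support, ¬ ∃ y ∈ segment ℝ (⟨c₀.re - r / 2, ys⟩ : ℂ) ⟨c₀.re + r / 2, ys⟩, y ∈ closedSq δ q)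
    (hB3₂ : ∀ q ∈ Λ₂.support, ¬ ∃ y ∈ segment ℝ (⟨c₀.re - r / 2, ys⟩ : ℂ) ⟨c₀.re + r / 2, ys⟩, y ∈ closedSq δ q)
    (hcol : ⌊(c₀.re - r / 2) / δ⌋ + 1 ≤ C 0) (hcol' : C 0 ≤ ⌊(c₀.re + r / 2) / δ⌋)
    (hrow : C 1 ≤ ⌊ys / δ⌋) (hrow' : ⌊ys / δ⌋ + 1 ≤ C 1 + k) :
    walkWinding ((Λ₁.append (upRun C k)).append Λ₂) (floorSq δ (ΓH 0)) -
      walkWinding ((Λ₁.append (upRun C k)).append Λ₂) (floorSq δ (ΓH 1)) = 1 := by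
  set Λ := (Λ₁.append (upRun C k)).append Λ₂ with hΛ
  set Qhm : ℂ := ⟨c₀.re - r / 2, ys⟩ with hQhm
  set Qhp : ℂ := ⟨c₀.re + r / 2, ys⟩ with hQhp
  set Xm : ℤ := ⌊(c₀.re - r / 2) / δ⌋ with hXm
  set Xp : ℤ := ⌊(c₀.re + r / 2) / δ⌋ with hXp
  set Ys : ℤ := ⌊ys / δ⌋ with hYs
  have hXmp : Xm ≤ Xp := by omega
  set m : ℕ := (Xp - Xm).toNat with hm
  have hmz : (m : ℤ) = Xp - Xm := Int.toNat_of_nonneg (by omega)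
  set ur : Site 2 := ![Xm, Ys] with hur
  have hurfl : floorSq δ Qhm = ur := by rw [hQhm, floorSq_mk]
  have hurpfl : ur + (m : ℤ) • (Pi.single 0 1 : Site 2) = floorSq δ Qhp := by
    rw [hQhp, floorSq_mk]; ext i; fin_cases i <;> simp [hur, hmz, hXp, hYs]
  have hIcc1 : ∀ {u v : ℝ}, 0 ≤ u → v ≤ 1 → Icc u v ⊆ Icc 0 1 := fun hu hv => Icc_subset_Icc hu hv
  -- the face walks along `Γ_H`
  set fs : Site 2 := floorSq δ (ΓH 0) with hfs
  set fe : Site 2 := floorSq δ (ΓH 1) with hfe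
  obtain ⟨π₁, -, hπ₁s⟩ := exists_dualWalk_of_path hδ hsᵢ.le (hHc.mono (hIcc1 le_rfl (hsᵢₒ.le.trans hsₒ.le)))
    (P := fs) (P' := floorSq δ (ΓH sᵢ)) (mem_closedSq_floorSq hδ _) (mem_closedSq_floorSq hδ _)
  obtain ⟨hM₂c, hM₂0, hM₂1, hM₂im⟩ := lineMap_props (ΓH sᵢ) Qhm
  obtain ⟨π₂, -, hπ₂s⟩ := exists_dualWalk_of_path hδ zero_le_one hM₂c (P := floorSq δ (ΓH sᵢ)) (P' := ur)
    (by show AffineMap.lineMap _ _ (0 : ℝ) ∈ _; rw [hM₂0]; exact mem_closedSq_floorSq hδ _)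
    (by show AffineMap.lineMap _ _ (1 : ℝ) ∈ _; rw [hM₂1, ← hurfl]; exact mem_closedSq_floorSq hδ _)
  obtain ⟨hM₄c, hM₄0, hM₄1, hM₄im⟩ := lineMap_props Qhp (ΓH sₒ)
  obtain ⟨π₄, -, hπ₄s⟩ := exists_dualWalk_of_path hδ zero_le_one hM₄c (P := floorSq δ Qhp) (P' := floorSq δ (ΓH sₒ))
    (by show AffineMap.lineMap _ _ (0 : ℝ) ∈ _; rw [hM₄0]; exact mem_closedSq_floorSq hδ _)
    (by show AffineMap.lineMap _ _ (1 : ℝ) ∈ _; rw [hM₄1]; exact mem_closedSq_floorSq hδ _)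
  obtain ⟨π₅, -, hπ₅s⟩ := exists_dualWalk_of_path hδ hsₒ.le (hHc.mono (hIcc1 (hsᵢ.le.trans hsᵢₒ.le) le_rfl))
    (P := floorSq δ (ΓH sₒ)) (P' := fe) (mem_closedSq_floorSq hδ _) (mem_closedSq_floorSq hδ _)
  set P₁ : (zdGraph 2).Walk fs ur := π₁.append π₂ with hP₁
  set P₂ : (zdGraph 2).Walk (ur + (m : ℤ) • (Pi.single 0 1 : Site 2)) fe := (π₄.copy hurpfl.symm rfl).append π₅ with hP₂
  have hP₁touch : ∀ q ∈ P₁.support, ∃ y ∈ ΓH '' Icc 0 sᵢ ∪ segment ℝ (ΓH sᵢ) Qhm ∪ segment ℝ Qhp (ΓH sₒ) ∪ ΓH '' Icc sₒ 1,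
      y ∈ closedSq δ q := by
    intro q hq
    rw [hP₁, Walk.mem_support_append_iff] at hq
    rcases hq with hq | hq
    · obtain ⟨y, hy, hyq⟩ := near_of_shadow hπ₁s hq; exact ⟨y, Or.inl (Or.inl (Or.inl hy)), hyq⟩
    · obtain ⟨y, hy, hyq⟩ := near_of_shadow hπ₂s hq; rw [hM₂im] at hy; exact ⟨y, Or.inl (Or.inl (Or.inr hy)), hyq⟩
  have hP₂touch : ∀ q ∈ P₂.support, ∃ y ∈ ΓH '' Icc 0 sᵢ ∪ segment ℝ (ΓH sᵢ) Qhm ∪ segment ℝ Qhp (ΓH sₒ) ∪ ΓH '' Icc sₒ 1,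
      y ∈ closedSq δ q := by
    intro q hq
    rw [hP₂, Walk.mem_support_append_iff, Walk.support_copy] at hq
    rcases hq with hq | hq
    · obtain ⟨y, hy, hyq⟩ := near_of_shadow hπ₄s hq; rw [hM₄im] at hy; exact ⟨y, Or.inl (Or.inr hy), hyq⟩
    · obtain ⟨y, hy, hyq⟩ := near_of_shadow hπ₅s hq; exact ⟨y, Or.inr hy, hyq⟩
  have hP₁Λ : ∀ q ∈ P₁.support, q ∉ Λ.support := fun q hq hqΛ => hBout q hqΛ (hP₁touch q hq)
  have hP₂Λ : ∀ q ∈ P₂.support, q ∉ Λ.support := fun q hq hqΛ => hBout q hqΛ (hP₂touch q hq)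
  -- the squares right of the run faces touch the middle segment
  have hXmlo : (Xm : ℝ) * δ ≤ c₀.re - r / 2 := by
    have := Int.floor_le ((c₀.re - r / 2) / δ); rwa [le_div_iff₀ hδ] at this
  have hXphi : (Xp : ℝ) * δ ≤ c₀.re + r / 2 := by
    have := Int.floor_le ((c₀.re + r / 2) / δ); rwa [le_div_iff₀ hδ] at this
  have hYslo : (Ys : ℝ) * δ ≤ ys := by
    have := Int.floor_le (ys / δ); rwa [le_div_iff₀ hδ] at this
  have hYshi : ys ≤ ((Ys : ℝ) + 1) * δ := by
    have := (Int.lt_floor_add_one (ys / δ)).le; rwa [div_le_iff₀ hδ] at this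
  have hright : ∀ j < m, ur + (j : ℤ) • (Pi.single 0 1 : Site 2) + Pi.single 0 1 ∉ Λ₁.support ∧
      ur + (j : ℤ) • (Pi.single 0 1 : Site 2) + Pi.single 0 1 ∉ Λ₂.support := by
    intro j hj
    set X : ℤ := Xm + j + 1 with hX
    have hsq : ur + (j : ℤ) • (Pi.single 0 1 : Site 2) + Pi.single 0 1 = ![X, Ys] := by
      ext i; fin_cases i <;> simp only [Pi.add_apply, Pi.smul_apply, smul_eq_mul] <;> simp [hur, hX]
    have hjm : (j : ℤ) + 1 ≤ m := by exact_mod_cast hj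
    have hX1 : c₀.re - r / 2 ≤ (X : ℝ) * δ := by
      have : ((Xm : ℝ) + 1) * δ ≤ (X : ℝ) * δ := by
        apply mul_le_mul_of_nonneg_right _ hδ.le
        rw [hX]; push_cast; have : (0:ℝ) ≤ j := by positivity
        linarith
      have hXmhi : c₀.re - r / 2 < ((Xm : ℝ) + 1) * δ := by
        have := Int.lt_floor_add_one ((c₀.re - r / 2) / δ); rwa [div_lt_iff₀ hδ] at this
      linarith
    have hX2 : (X : ℝ) * δ ≤ c₀.re + r / 2 := by
      have : (X : ℝ) * δ ≤ (Xp : ℝ) * δ := by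
        apply mul_le_mul_of_nonneg_right _ hδ.le
        have : X ≤ Xp := by rw [hX]; omega
        exact_mod_cast this
      linarith
    have htouch : ∃ y ∈ segment ℝ Qhm Qhp, y ∈ closedSq δ (![X, Ys] : Site 2) := by
      refine ⟨⟨(X : ℝ) * δ, ys⟩, ?_, ?_⟩
      · rw [hQhm, hQhp]
        refine ⟨(c₀.re + r / 2 - X * δ) / r, (X * δ - (c₀.re - r / 2)) / r, by
          apply div_nonneg _ hr.le; linarith, by apply div_nonneg _ hr.le; linarith, by field_simp; ring, ?_⟩
        apply Complex.ext <;> simp <;> field_simp <;> ring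
      · refine ⟨?_, ?_, ?_, ?_⟩ <;> simp
        · linarith
        · nlinarith
        · linarith
        · linarith
    rw [hsq]
    exact ⟨fun h' => hB3₁ _ h' htouch, fun h' => hB3₂ _ h' htouch⟩
  have hcol₀ : ur 0 + 1 ≤ C 0 := by simp [hur]; omega
  have hcol₀' : C 0 ≤ ur 0 + m := by simp [hur, hmz]; omega
  have hrow₀ : C 1 ≤ ur 1 := by simp [hur]; omega
  have hrow₀' : ur 1 + 1 ≤ C 1 + k := by simp [hur]; omega
  exact walkWinding_sub_eq_one_of_cross Λ₁ Λ₂ P₁ P₂ hP₁Λ hP₂Λ hright hcol₀ hcol₀' hrow₀ hrow₀'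

/-! ### The flux identity for the crosscut loop -/

open Classical in
/-- **The flux identity for the crosscut loop.** Let `Λ = (n_b → p_b) ++ v ++ (p_t → n_t) ++ β`
be a closed lattice walk with `v` a walk of inner faces starting in the component of the base
face `p₀`, `β` carrying no flux of the current of the potential `h` (harmonic off the disjoint
discrete arcs `A_δ`, `B_δ` of the arcs `0`, `2`). If no square of `Λ` touches a point within `2δ`
of the arcs `0`, `2`, and the winding numbers of `Λ` around the squares of the end points
`boundary σ₀ ∈ arc j_L`, `boundary σ₁ ∈ arc j_R` (`{j_L, j_R} = {0, 2}`) differ by `1`, then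
`E(p_t, n_t) - E(p_b, n_b) = σ · Σ_{x ∈ A_δ} div(x)`, `σ = 1` if `j_L = 0`, `σ = -1` if `j_L = 2`.
[cite: GeorgakopoulosPanagiotis2019, §3 (duality, on `ℤ²`)] -/
theorem faceExitVal_sub_eq_of_crossData (R : ConformalRectangle) (hδ : 0 < δ) {h : Site 2 → ℝ}
    (hfin : (discreteArc R.carrier δ (R.arc 0)).Finite)
    (hTB : Disjoint (discreteArc R.carrier δ (R.arc 0)) (discreteArc R.carrier δ (R.arc 2)))
    (hharm : ∀ x, x ∉ discreteArc R.carrier δ (R.arc 0) → x ∉ discreteArc R.carrier δ (R.arc 2) →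
      ∑ y ∈ ((zdGraph 2).neighborFinset x).filter (fun y => (discreteDomainGraph R.carrier δ).Adj x y), (h y - h x) = 0)
    {p₀ : Site 2} (hp₀ : IsInnerFace R.carrier δ p₀)
    {pb nb pt nt : Site 2} (hpbnb : (zdGraph 2).Adj pb nb) (hptnt : (zdGraph 2).Adj pt nt)
    (v : (zdGraph 2).Walk pb pt) (hv : ∀ z ∈ v.support, IsInnerFace R.carrier δ z)
    (hpbF : (faceGraph R.carrier δ).Reachable p₀ pb)
    (β : (zdGraph 2).Walk nt nb) (hβ : walkFlux (ecurH R.carrier δ h) (ecurV R.carrier δ h) β = 0)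
    {jL jR : Fin 4} (hLR : (jL = 0 ∧ jR = 2) ∨ (jL = 2 ∧ jR = 0)) {σ₀ σ₁ : ℝ}
    (hσ₀ : σ₀ ∈ Ioo (R.mark jL) (R.nextMark jL)) (hσ₁ : σ₁ ∈ Ioo (R.mark jR) (R.nextMark jR))
    (harcface : ∀ i : Fin 4, (i = 0 ∨ i = 2) → ∀ f : Site 2,
      (∃ w ∈ closedSq δ f, Metric.infDist w (R.arc i) ≤ 2 * δ) →
        f ∉ ((Walk.cons hpbnb.symm v).append (Walk.cons hptnt β)).support)
    (hcross : walkWinding ((Walk.cons hpbnb.symm v).append (Walk.cons hptnt β)) (floorSq δ (R.boundary σ₀)) -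
      walkWinding ((Walk.cons hpbnb.symm v).append (Walk.cons hptnt β)) (floorSq δ (R.boundary σ₁)) = 1) :
    faceExitVal R.carrier δ h p₀ pt nt - faceExitVal R.carrier δ h p₀ pb nb =
      (if jL = 0 then (1 : ℝ) else -1) *
        ∑ x ∈ hfin.toFinset, divAt (ecurH R.carrier δ h) (ecurV R.carrier δ h) (x - 1) := by
  set Λ := (Walk.cons hpbnb.symm v).append (Walk.cons hptnt β) with hΛ
  set fs : Site 2 := floorSq δ (R.boundary σ₀) with hfs
  set fe : Site 2 := floorSq δ (R.boundary σ₁) with hfe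
  -- the winding number is constant on the faces at the discrete arcs
  have hwind_arc : ∀ (i : Fin 4), (i = 0 ∨ i = 2) → ∀ {σₑ : ℝ}, σₑ ∈ Ioo (R.mark i) (R.nextMark i) →
      ∀ x ∈ discreteArc R.carrier δ (R.arc i), walkWinding Λ (x - 1) = walkWinding Λ (floorSq δ (R.boundary σₑ)) := by
    intro i hi σₑ hσₑ x hx
    obtain ⟨Px, hPx⟩ := exists_faceWalk_along_arc R hδ i hx (Ioo_subset_Icc_self hσₑ)
    exact walkWinding_eq_of_walk_closed Λ Px fun f hf => harcface i hi f (hPx f hf)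
  -- the index sets
  have hfinB : (discreteArc R.carrier δ (R.arc 2)).Finite := (meshDomain_finite R.isBounded hδ).subset fun x hx => hx.1.1
  set ST : Finset (Site 2) := hfin.toFinset.image (fun x => x - 1) with hST
  set SB : Finset (Site 2) := hfinB.toFinset.image (fun x => x - 1) with hSB
  have hSTmem : ∀ u, u ∈ ST ↔ u + 1 ∈ discreteArc R.carrier δ (R.arc 0) := by
    intro u
    rw [hST, Finset.mem_image]
    constructor
    · rintro ⟨x, hx, rfl⟩; rw [sub_add_cancel]; exact (Set.Finite.mem_toFinset _).1 hx
    · intro hu; exact ⟨u + 1, (Set.Finite.mem_toFinset _).2 hu, by abel⟩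
  have hSBmem : ∀ u, u ∈ SB ↔ u + 1 ∈ discreteArc R.carrier δ (R.arc 2) := by
    intro u
    rw [hSB, Finset.mem_image]
    constructor
    · rintro ⟨x, hx, rfl⟩; rw [sub_add_cancel]; exact (Set.Finite.mem_toFinset _).1 hx
    · intro hu; exact ⟨u + 1, (Set.Finite.mem_toFinset _).2 hu, by abel⟩
  -- winding constants
  set kT : ℤ := walkWinding Λ (if jL = 0 then fs else fe) with hkT
  set kB : ℤ := walkWinding Λ (if jL = 0 then fe else fs) with hkB
  have hwT : ∀ u ∈ ST, walkWinding Λ u = kT := by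
    intro u hu
    rw [hkT]
    have hx := (hSTmem u).1 hu
    rw [show u = (u + 1) - 1 by abel]
    rcases hLR with ⟨hjL, hjR⟩ | ⟨hjL, hjR⟩
    · rw [if_pos hjL, hfs]; subst hjL; exact hwind_arc 0 (Or.inl rfl) hσ₀ _ hx
    · rw [if_neg (by rw [hjL]; decide), hfe]; subst hjR; exact hwind_arc 0 (Or.inl rfl) hσ₁ _ hx
  have hwB : ∀ u ∈ SB, walkWinding Λ u = kB := by
    intro u hu
    rw [hkB]
    have hx := (hSBmem u).1 hu
    rw [show u = (u + 1) - 1 by abel]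
    rcases hLR with ⟨hjL, hjR⟩ | ⟨hjL, hjR⟩
    · rw [if_pos hjL, hfe]; subst hjR; exact hwind_arc 2 (Or.inr rfl) hσ₁ _ hx
    · rw [if_neg (by rw [hjL]; decide), hfs]; subst hjL; exact hwind_arc 2 (Or.inr rfl) hσ₀ _ hx
  have hTsub : discreteArc R.carrier δ (R.arc 0) ⊆ meshBoundary R.carrier δ := fun x hx => hx.1
  have hBsub : discreteArc R.carrier δ (R.arc 2) ⊆ meshBoundary R.carrier δ := fun x hx => hx.1
  have hident := faceExitVal_sub_faceExitVal_eq R hδ hTsub hBsub hTB hharm hp₀ hpbnb.symm hptnt v hv hpbF β hβ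
    ST SB hSTmem hSBmem hwT hwB
  -- conclusion
  have hkdiff : ((kT - kB : ℤ) : ℝ) = if jL = 0 then (1 : ℝ) else -1 := by
    rcases hLR with ⟨hjL, -⟩ | ⟨hjL, -⟩
    · simp only [hkT, hkB, if_pos hjL]; rw [hcross]; simp
    · have hne : jL ≠ 0 := by rw [hjL]; decide
      simp only [hkT, hkB, if_neg hne]
      rw [show walkWinding Λ fe - walkWinding Λ fs = -(walkWinding Λ fs - walkWinding Λ fe) by ring, hcross]; simp
  have hsum : ∑ u ∈ ST, divAt (ecurH R.carrier δ h) (ecurV R.carrier δ h) u =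
      ∑ x ∈ hfin.toFinset, divAt (ecurH R.carrier δ h) (ecurV R.carrier δ h) (x - 1) := by
    rw [hST, Finset.sum_image fun x _ y _ h => sub_left_inj.1 h]
  rw [hident, hkdiff, hsum]

end KirchhoffSlope

end Summit.CriticalPhenomena.CardyFormulaZ2.Theorems
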